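import Mathlib
import Summits.Ventures.HodgeRepro.OcticCMPointGaloisRing16Ideal

/-!
# OcticCMPointGaloisRing16Sign — the conductor-`4` root numbers at the inert place `𝔮 | 2` of the octic point

Blind re-derivation cell `pub-hodge-repro`, seat night-2 (gen 5).  Target tree path
`lean/Summits/Ventures/HodgeRepro/OcticCMPointGaloisRing16Sign.lean`.  On `GR(16, 4) = 𝒪/𝔮⁴`
(`OcticCMPointGaloisRing16` / `-Prim` / `-Ideal`: `σ = Frobenius²`, the primitive `σ`-odd `ψ̃_δ`, the ideal
`I = 4GR = 𝔮²/𝔮⁴` with `I · I = 0`, `ψ̃_δ`-annihilator `I`, `|I| = 256`):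

* **The `σ`-fixed residues.**  `σ` acts on the residues `(ℤ/4)⁴` of `GR(16, 4)/4GR = GR(4, 4)` by the explicit
  linear map `sigmaRes` (from `r⁴, r⁸, r¹²` in coordinates), and its fixed vectors are exactly the `ℤ/4`-span of
  `red4 1 = (1,0,0,0)` and `red4 (r⁵) = (0,3,1,2)` — the residue ring `GR(4, 2)` of the `σ`-fixed subring `GR(16, 2)`
  (`sigmaRes_fixed`, by `decide`).  Hence every `a` with `σ(a) ≡ a` mod `I` is `≡ a₀ := α + β r⁵` mod `I` with `a₀`
  `σ`-FIXED in `GR(16, 4)` (`exists_fixed_lift`; `σ(r⁵) = r²⁰ = r⁵`).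
* **The conductor-`4` root numbers** (`eps_four_inert`): for EVERY conjugate-dual character `ρ` of conductor exactly
  `4` (`ρ(1 + z) = ψ̃_δ(a z)` on `I`, `a` a unit), `ε(½, ρ, ψ̃_δ) = ρ(ϖ)^n · ρ(a₀)^{−1}` with `a₀` a `σ`-fixed unit
  `≡ a` mod `I` and `ρ(a₀)² = 1` — the `ψ̃_δ`-sign is `+1` because `ψ̃_δ` is trivial on the `σ`-fixed elements
  (`tr(δ t) = 0`, the Frobenius-sum argument of gen 5's `OcticCMPointGaloisRingE3` at conductor `2`).  Hence
  (`eps_four_inert_of_trivial`) `ε = ρ(ϖ)^n` exactly for `ρ` trivial on the `σ`-fixed units, (`E3_four_inert`) (E3) at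
  `𝔮`, conductor `4`, for four such lines is the `ϖ`-part of N2, and (`E3_four_inert_iff`) in general (E3) is an identity
  of the signs `ρ_j(a₀_j)`.

The sign `ρ(a₀)` is in fact `+1`: every `σ`-fixed unit of `GR(16, 4)` is a norm `v σ(v)` (Hensel on the model,
`OcticCMPointGaloisRing16Norm.lean`), so `ε(½, ρ, ψ̃_δ) = ρ(ϖ)^n` exactly (`eps_four_inert_exact` there) — as at
conductor `2` (`OcticCMPointGaloisRingE3.eps_conjDual_exact`, where `θ⁵ = 1` kills the tame part).

**What this is not.**  The norm surjectivity (the next module), odd conductors at `𝔮`, and the four `χ′_j` of the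
face are NOT here.  Nothing here says anything about the status of the Hodge conjecture for CM abelian varieties, which is NOT
proved.
-/

set_option autoImplicit false

noncomputable section

open Polynomial Classical

namespace Summit.Ventures.HodgeRepro.PeriodCloser

namespace GaloisRing16

open GaussSumStability

/-! ### `σ` on coordinates and on residues mod `4` -/

/-- `algebraMap` of a numeral (for `simp`). -/
theorem algebraMap_num (n : ℕ) [n.AtLeastTwo] :
    algebraMap (ZMod 16) GR164 (OfNat.ofNat n) = OfNat.ofNat n := map_ofNat _ _

/-- **`σ` in coordinates**: `σ(c₀ + c₁ r + c₂ r² + c₃ r³) = c₀ + c₁ r⁴ + c₂ r⁸ + c₃ r¹²` with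
`r⁴ = 15 + 13r + 2r² + 4r³`, `r⁸ = 5 + 2r + 13r² + 12r³`, `r¹² = 13 + 9r + 15r² + 5r³`. -/
theorem conjGR_comb (c₀ c₁ c₂ c₃ : ZMod 16) :
    conjGR (c₀ • (1 : GR164) + c₁ • r + c₂ • r ^ 2 + c₃ • r ^ 3) =
      (c₀ + 15 * c₁ + 5 * c₂ + 13 * c₃) • (1 : GR164) + (13 * c₁ + 2 * c₂ + 9 * c₃) • r +
        (2 * c₁ + 13 * c₂ + 15 * c₃) • r ^ 2 + (4 * c₁ + 12 * c₂ + 5 * c₃) • r ^ 3 := by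
  have hrel := r_rel
  have h16 := sixteen_eq_zero
  have h4 : algebraMap (ZMod 16) GR164 4 = 4 := map_ofNat _ _
  have h2 : algebraMap (ZMod 16) GR164 2 = 2 := map_ofNat _ _
  have h5 : algebraMap (ZMod 16) GR164 5 = 5 := map_ofNat _ _
  have h9 : algebraMap (ZMod 16) GR164 9 = 9 := map_ofNat _ _
  have h12 : algebraMap (ZMod 16) GR164 12 = 12 := map_ofNat _ _
  have h13 : algebraMap (ZMod 16) GR164 13 = 13 := map_ofNat _ _
  have h15 : algebraMap (ZMod 16) GR164 15 = 15 := map_ofNat _ _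
  rw [map_add, map_add, map_add, map_smul, map_smul, map_smul, map_smul, map_one, map_pow, map_pow, conjGR_r,
    ← pow_mul, ← pow_mul]
  simp only [smul_eq_num, map_add, map_mul, h2, h4, h5, h9, h12, h13, h15]
  set a₀ := algebraMap (ZMod 16) GR164 c₀
  set a₁ := algebraMap (ZMod 16) GR164 c₁
  set a₂ := algebraMap (ZMod 16) GR164 c₂
  set a₃ := algebraMap (ZMod 16) GR164 c₃
  linear_combination (a₁ * ((1 : GR164)) + a₂ * ((14955 : GR164) + (-1395 : GR164) * r + (130 : GR164) * r ^ 2 + (-12 : GR164) * r ^ 3 + (1 : GR164) * r ^ 4) + a₃ * ((197445395 : GR164) + (-18419730 : GR164) * r + (1718381 : GR164) * r ^ 2 + (-160308 : GR164) * r ^ 3 + (14955 : GR164) * r ^ 4 + (-1395 : GR164) * r ^ 5 + (130 : GR164) * r ^ 6 + (-12 : GR164) * r ^ 7 + (1 : GR164) * r ^ 8)) * hrel +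
    (a₁ * ((-1 : GR164) + (-1 : GR164) * r + (-1 : GR164) * r ^ 2 + (-1 : GR164) * r ^ 3) + a₂ * ((-935 : GR164) + (-2717 : GR164) * r + (-12833 : GR164) * r ^ 2 + (-10020 : GR164) * r ^ 3) + a₃ * ((-12340338 : GR164) + (-35869779 : GR164) * r + (-169418421 : GR164) * r ^ 2 + (-132278960 : GR164) * r ^ 3)) * h16

/-- `red4` of a scalar multiple: `red4 (c • y) = c4 c • red4 y`. -/
theorem red4_smul (c : ZMod 16) (y : GR164) : red4 (c • y) = c4 c • red4 y := by
  funext i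
  simp [red4, map_smul, map_mul]

/-- `red4` of a combination. -/
theorem red4_comb (c₀ c₁ c₂ c₃ : ZMod 16) :
    red4 (c₀ • (1 : GR164) + c₁ • r + c₂ • r ^ 2 + c₃ • r ^ 3) = ![c4 c₀, c4 c₁, c4 c₂, c4 c₃] := by
  funext i
  unfold red4
  rw [coords_comb]
  fin_cases i <;> rfl

/-- **`σ` on residues**: the linear map of `(ℤ/4)⁴` induced by `σ`. -/
def sigmaRes (v : Fin 4 → ZMod 4) : Fin 4 → ZMod 4 :=
  ![v 0 + 3 * v 1 + v 2 + v 3, v 1 + 2 * v 2 + v 3, 2 * v 1 + v 2 + 3 * v 3, v 3]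

/-- `red4 (σ y) = sigmaRes (red4 y)`. -/
theorem red4_conjGR (y : GR164) : red4 (conjGR y) = sigmaRes (red4 y) := by
  have e2 : c4 2 = 2 := by decide
  have e4 : c4 4 = 0 := by decide
  have e5 : c4 5 = 1 := by decide
  have e9 : c4 9 = 1 := by decide
  have e12 : c4 12 = 0 := by decide
  have e13 : c4 13 = 1 := by decide
  have e15 : c4 15 = 3 := by decide
  conv_lhs => rw [eq_comb y, conjGR_comb, red4_comb]
  conv_rhs => rw [eq_comb y, red4_comb]
  funext i
  fin_cases i <;> simp [sigmaRes, map_add, map_mul, e2, e4, e5, e9, e12, e13, e15]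

/-- The residue of `r⁵` is `(0, 3, 1, 2)` (`r⁵ = 12 + 3r + 5r² + 2r³`). -/
theorem red4_r_pow_five : red4 (r ^ 5) = ![0, 3, 1, 2] := by
  have hrel := r_rel
  have h16 := sixteen_eq_zero
  have h2 : algebraMap (ZMod 16) GR164 2 = 2 := map_ofNat _ _
  have h3 : algebraMap (ZMod 16) GR164 3 = 3 := map_ofNat _ _
  have h5 : algebraMap (ZMod 16) GR164 5 = 5 := map_ofNat _ _
  have h12 : algebraMap (ZMod 16) GR164 12 = 12 := map_ofNat _ _
  rw [show r ^ 5 = (12 : ZMod 16) • (1 : GR164) + (3 : ZMod 16) • r + (5 : ZMod 16) • r ^ 2 + (2 : ZMod 16) • r ^ 3 by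
    simp only [smul_eq_num, h2, h3, h5, h12]; linear_combination ((-12 : GR164) + (1 : GR164) * r) * hrel + ((2 : GR164) * r + (10 : GR164) * r ^ 2 + (8 : GR164) * r ^ 3) * h16]
  rw [red4_comb]
  decide

/-- `red4 1 = (1, 0, 0, 0)`. -/
theorem red4_one : red4 (1 : GR164) = ![1, 0, 0, 0] := by
  have := red4_comb 1 0 0 0
  simp only [one_smul, zero_smul, add_zero] at this
  rw [this]
  decide

/-- **The `σ`-fixed residues are the span of `red4 1` and `red4 (r⁵)`** (`decide` over `(ℤ/4)⁴`). -/
theorem sigmaRes_fixed (v : Fin 4 → ZMod 4) (hv : sigmaRes v = v) :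
    ∃ α β : ZMod 4, v = α • ![1, 0, 0, 0] + β • ![0, 3, 1, 2] := by
  have h0 := congrFun hv 0
  have h1 := congrFun hv 1
  have h2 := congrFun hv 2
  simp only [sigmaRes, Matrix.cons_val_zero, Matrix.cons_val_one, Matrix.head_cons, Matrix.cons_val_two,
    Matrix.tail_cons] at h0 h1 h2
  have h4 : (4 : ZMod 4) = 0 := by decide
  refine ⟨v 0, 3 * v 1, ?_⟩
  funext i
  fin_cases i
  · show v 0 = v 0 * 1 + 3 * v 1 * 0
    ring
  · show v 1 = v 0 * 0 + 3 * v 1 * 3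
    linear_combination (-2 * v 1) * h4
  · show v 2 = v 0 * 0 + 3 * v 1 * 1
    linear_combination h0 - 3 * h2 + 2 * v 3 * h4
  · show v 3 = v 0 * 0 + 3 * v 1 * 2
    linear_combination 3 * h2 + (-2 * v 3 - 3 * v 1) * h4

/-- The lift `ℤ/4 → ℤ/16`, `t ↦ t.val`, is a section of `c4`. -/
theorem c4_lift (t : ZMod 4) : c4 ((t.val : ℕ) : ZMod 16) = t := by
  revert t; decide

/-- `σ(r⁵) = r⁵`. -/
theorem conjGR_r_pow_five : conjGR (r ^ 5) = r ^ 5 := by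
  rw [map_pow, conjGR_r, ← pow_mul, show 4 * 5 = 15 + 5 by norm_num, pow_add, r_pow_fifteen, one_mul]

/-- **Every `a` with `σ(a) ≡ a` mod `I` is congruent mod `I` to a `σ`-fixed element `α + β r⁵`.** -/
theorem exists_fixed_lift (a : GR164) (h : conjGR a - a ∈ I4) :
    ∃ a₀ : GR164, conjGR a₀ = a₀ ∧ a - a₀ ∈ I4 := by
  have hres : sigmaRes (red4 a) = red4 a := by
    rw [← red4_conjGR]
    exact (sub_mem_I4_iff _ _).1 h
  obtain ⟨α, β, hv⟩ := sigmaRes_fixed (red4 a) hres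
  refine ⟨((α.val : ℕ) : ZMod 16) • (1 : GR164) + ((β.val : ℕ) : ZMod 16) • r ^ 5, ?_, ?_⟩
  · rw [map_add, map_smul, map_smul, map_one, conjGR_r_pow_five]
  · rw [sub_mem_I4_iff, red4_add, red4_smul, red4_smul, red4_one, red4_r_pow_five, c4_lift, c4_lift]
    exact hv

/-! ### The conductor-`4` root numbers -/

/-- `σ` as a ring homomorphism. -/
def σ16 : GR164 →+* GR164 := conjGR.toRingHom

/-- `σ16 y = σ(y)`. -/
theorem σ16_apply (y : GR164) : σ16 y = conjGR y := rfl

/-- An element congruent mod `I` to a unit is a unit (`I · I = 0`). -/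
theorem isUnit_of_sub_mem_I4 (a : GR164ˣ) (a₀ : GR164) (h : (a : GR164) - a₀ ∈ I4) : IsUnit a₀ := by
  have hz : ((a⁻¹ : GR164ˣ) : GR164) * ((a : GR164) - a₀) ∈ I4 := I4.mul_mem_left _ h
  have ho2 : (((a⁻¹ : GR164ˣ) : GR164) * ((a : GR164) - a₀)) * (((a⁻¹ : GR164ˣ) : GR164) * ((a : GR164) - a₀)) = 0 :=
    I4_sq _ hz _ hz
  have hinv := Units.mul_inv a
  have heq : a₀ = (a : GR164) * (1 - ((a⁻¹ : GR164ˣ) : GR164) * ((a : GR164) - a₀)) := by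
    linear_combination ((a : GR164) - a₀) * hinv
  rw [heq]
  refine a.isUnit.mul (IsUnit.of_mul_eq_one (1 + ((a⁻¹ : GR164ˣ) : GR164) * ((a : GR164) - a₀)) ?_)
  linear_combination -ho2

/-- **The conductor-`4` root number at `𝔮 | 2` of a conjugate-dual character**: for `ρ` with `ρ ∘ σ = ρ⁻¹` on the
units and `ρ(1 + z) = ψ̃_δ(a z)` on `I = 4GR` (`a` a unit: conductor exactly `4`), there is a `σ`-fixed unit `a₀ ≡ a`
mod `I` with `ρ(a₀)² = 1` and `ε(½, ρ, ψ̃_δ) = ρ(ϖ)^n · ρ(a₀)^{−1}` (`κ = 1/256 = |𝒪/𝔮⁴|^{−1/2}`). -/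
theorem eps_four_inert (n : ℕ) (ρ : LocalChar GR164) (hσ : ∀ x, ρ.unit (conjGR x) = ρ.unit⁻¹ x) (a : GR164ˣ)
    (hρ : LocalChar.Primitive psiTildeGR16 I4 ρ a) :
    ∃ a₀ : GR164ˣ, conjGR (a₀ : GR164) = a₀ ∧ (a : GR164) - a₀ ∈ I4 ∧ ρ.unit (a₀ : GR164) * ρ.unit (a₀ : GR164) = 1 ∧
      LocalChar.eps (1 / 256) n ρ psiTildeGR16 = ρ.piVal ^ n * (ρ.unit (a₀ : GR164))⁻¹ := by
  have hσ' : ∀ x, ρ.unit (σ16 x) = ρ.unit⁻¹ x := fun x => by rw [σ16_apply]; exact hσ x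
  have hψσ : ∀ x, psiTildeGR16 (σ16 x) = psiTildeGR16 (-x) := fun x => by rw [σ16_apply]; exact psiTildeGR16_conjGR x
  have hconj : σ16 (a : GR164) - a ∈ I4 :=
    LocalChar.conj_sub_mem psiTildeGR16 I4 psiAnn_I4_iff σ16 (fun x => by rw [σ16_apply, σ16_apply]; exact conjGR_conjGR x)
      (fun z hz => by rw [σ16_apply]; exact conj_mem_I4 z hz) hψσ ρ hσ' a hρ
  rw [σ16_apply] at hconj
  obtain ⟨a₀, hσa₀, hsub⟩ := exists_fixed_lift a hconj
  have hu := isUnit_of_sub_mem_I4 a a₀ hsub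
  obtain ⟨h1, h2, -⟩ := LocalChar.eps_eq_of_conjDual (1 / 256) n ρ psiTildeGR16 I4 I4_sq psiAnn_I4_iff σ16 hσ' hψσ a hρ
    kappa_mul_card hu.unit (by rw [IsUnit.unit_spec, σ16_apply]; exact hσa₀) (by rw [IsUnit.unit_spec]; exact hsub)
  refine ⟨hu.unit, ?_, ?_, h2, ?_⟩
  · rw [IsUnit.unit_spec]
    exact hσa₀
  · rw [IsUnit.unit_spec]
    exact hsub
  · rw [h1, IsUnit.unit_spec, psiTildeGR16_eq_one_of_conjGR_fixed hσa₀, mul_one]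

/-- **`ε(½, ρ, ψ̃_δ) = ρ(ϖ)^n` exactly** for a conjugate-dual `ρ` of conductor exactly `4` trivial on the `σ`-fixed
units. -/
theorem eps_four_inert_of_trivial (n : ℕ) (ρ : LocalChar GR164) (hσ : ∀ x, ρ.unit (conjGR x) = ρ.unit⁻¹ x)
    (hfix : ∀ u : GR164ˣ, conjGR (u : GR164) = u → ρ.unit (u : GR164) = 1) (a : GR164ˣ)
    (hρ : LocalChar.Primitive psiTildeGR16 I4 ρ a) :
    LocalChar.eps (1 / 256) n ρ psiTildeGR16 = ρ.piVal ^ n := by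
  obtain ⟨a₀, hσa₀, -, -, heps⟩ := eps_four_inert n ρ hσ a hρ
  rw [heps, hfix a₀ hσa₀, inv_one, mul_one]

/-- **(E3) at `𝔮 | 2`, conductor `4`, for four conjugate-dual lines trivial on the `σ`-fixed units**: the `ϖ`-part
`π₀π₁ = π₂π₃` of N2 gives `ε₀ε₁ = ε₂ε₃`. -/
theorem E3_four_inert (n : ℕ) (ρ : Fin 4 → LocalChar GR164) (hσ : ∀ j x, (ρ j).unit (conjGR x) = (ρ j).unit⁻¹ x)
    (hfix : ∀ j (u : GR164ˣ), conjGR (u : GR164) = u → (ρ j).unit (u : GR164) = 1) (a : Fin 4 → GR164ˣ)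
    (hρ : ∀ j, LocalChar.Primitive psiTildeGR16 I4 (ρ j) (a j))
    (hN2 : (ρ 0).piVal * (ρ 1).piVal = (ρ 2).piVal * (ρ 3).piVal) :
    LocalChar.eps (1 / 256) n (ρ 0) psiTildeGR16 * LocalChar.eps (1 / 256) n (ρ 1) psiTildeGR16 =
      LocalChar.eps (1 / 256) n (ρ 2) psiTildeGR16 * LocalChar.eps (1 / 256) n (ρ 3) psiTildeGR16 := by
  rw [eps_four_inert_of_trivial n (ρ 0) (hσ 0) (hfix 0) (a 0) (hρ 0),
    eps_four_inert_of_trivial n (ρ 1) (hσ 1) (hfix 1) (a 1) (hρ 1),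
    eps_four_inert_of_trivial n (ρ 2) (hσ 2) (hfix 2) (a 2) (hρ 2),
    eps_four_inert_of_trivial n (ρ 3) (hσ 3) (hfix 3) (a 3) (hρ 3), ← mul_pow, hN2, mul_pow]

/-- **The sign structure in general**: for four conjugate-dual lines of conductor exactly `4`, `ε₀ε₁ = ε₂ε₃` iff
`(π₀π₁)^n s₀ s₁ = (π₂π₃)^n s₂ s₃` with `s_j = ρ_j(a₀_j)^{−1}` the signs at the `σ`-fixed representatives. -/
theorem E3_four_inert_iff (n : ℕ) (ρ : Fin 4 → LocalChar GR164)
    (hσ : ∀ j x, (ρ j).unit (conjGR x) = (ρ j).unit⁻¹ x) (a : Fin 4 → GR164ˣ)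
    (hρ : ∀ j, LocalChar.Primitive psiTildeGR16 I4 (ρ j) (a j)) :
    ∃ a₀ : Fin 4 → GR164ˣ, (∀ j, conjGR (a₀ j : GR164) = a₀ j) ∧ (∀ j, (a j : GR164) - a₀ j ∈ I4) ∧
      (∀ j, (ρ j).unit (a₀ j : GR164) * (ρ j).unit (a₀ j : GR164) = 1) ∧
      ((LocalChar.eps (1 / 256) n (ρ 0) psiTildeGR16 * LocalChar.eps (1 / 256) n (ρ 1) psiTildeGR16 =
          LocalChar.eps (1 / 256) n (ρ 2) psiTildeGR16 * LocalChar.eps (1 / 256) n (ρ 3) psiTildeGR16) ↔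
        ((ρ 0).piVal * (ρ 1).piVal) ^ n * (((ρ 0).unit (a₀ 0 : GR164))⁻¹ * ((ρ 1).unit (a₀ 1 : GR164))⁻¹) =
          ((ρ 2).piVal * (ρ 3).piVal) ^ n * (((ρ 2).unit (a₀ 2 : GR164))⁻¹ * ((ρ 3).unit (a₀ 3 : GR164))⁻¹)) := by
  choose a₀ hσa₀ hsub hsq heps using fun j => eps_four_inert n (ρ j) (hσ j) (a j) (hρ j)
  refine ⟨a₀, hσa₀, hsub, hsq, ?_⟩
  rw [heps 0, heps 1, heps 2, heps 3, mul_pow, mul_pow]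
  constructor <;> intro h <;> linear_combination h

end GaloisRing16

end Summit.Ventures.HodgeRepro.PeriodCloser

end
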